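import Mathlib
import HarnessLib
import Summits.Ventures.LatticeQCDFlow.Scoring.DoeblinGreenKubo
import Summits.Ventures.LatticeQCDFlow.Exactness.NCMCGeneralSpaceDoeblinPower

/-!
# The Poisson equation under a Doeblin POWER: a bounded solution `h − κh = f̄` for every bounded centred observable, Green–Kubo `Σ_t C_f̄(t) = ⟨f̄, h⟩_π`, and the martingale form of the asymptotic variance `π(h²) − π((κh)²) = Var_π f + 2 Σ_{t≥1} C_f̄(t)`

HONEST FRAMING: exact (Metropolis-corrected) sampling algorithms for lattice gauge theory;
figures of merit are autocorrelation/cost numbers at stated couplings and volumes; no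
continuum-physics claim.

Venture `LatticeQCDFlow` (cell pub-lqcd), topic `Exactness`; FANOUT row 13 (`eng-snf`, GEN-19).
NEW WORK of the cell, not a published result; no definition is introduced; nothing is cited as a
fact (the Poisson-equation form of the asymptotic variance — Meyn–Tweedie 1993 Thm 17.4.4 — is NAMED
ONLY).  Row 8 proved all of this for a ONE-step minorisation (`Scoring/DoeblinGreenKubo.lean` by the
invariant law, `Scoring/MinorisedGreenKubo.lean` by an arbitrary law: `poisson_exists_minorised`,
`greenKubo_hasSum_minorised`); the iteration kernel of the engine's NCMC lane is minorised only in TWO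
steps (GEN-18 `NCMCGeneralSpaceOccupancyChainDoeblin`).  This file redoes the chapter from an ABSTRACT
summable sup-norm decay rate and instantiates it with GEN-18's `m`-step toolkit
(`NCMCGeneralSpaceDoeblinPower`: `|∫ g dκᵗ(x,·) − π g| ≤ (1 − ε)^{⌊t/m⌋}`); row 8's finite Green–Kubo
identity `Scoring.sum_autocov_eq_of_poisson` and bookkeeping (`Scoring.kop`, `Scoring.autocov`,
`Scoring.iterate_kop_sub_const`, `Scoring.summable_pow_div`, `Scoring.tsum_pow_div_le`) are REUSED.
It is the observable-side input of the Markov-chain CLT under a Doeblin power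
(`NCMCGeneralSpaceDoeblinPowerCLT.lean`).

## Content (`κ` Markov on `S`, `π` an invariant probability law; observables bounded measurable)

§1 from an envelope: **`poisson_exists_of_envelope`** — if `|(kop κ)^[t] f x| ≤ b_t` with `Σ b_t < ∞`
then the Neumann series `h = Σ_t (kop κ)^[t] f` is measurable, `|h| ≤ Σ b_t`, and `h − kop κ h = f`;
**`greenKubo_hasSum_of_decay`** — if every bounded centred `g` decays as `|(kop κ)^[t] g| ≤ 2C_g r_t`
with `Σ r_t < ∞`, then for `f` centred and ANY bounded measurable Poisson solution `h`,
`HasSum (t ↦ autocov κ π f t) (∫ f h dπ)`;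
**`integral_sq_sub_sq_kop_eq`** (`∫ h² dπ − ∫ (kop κ h)² dπ = 2∫ f h dπ − ∫ f² dπ`, algebra) and
**`integral_sq_sub_sq_kop_eq_greenKubo`** — THE MARTINGALE FORM OF THE ASYMPTOTIC VARIANCE:
`∫ h² dπ − ∫ (kop κ h)² dπ = ∫ f² dπ + 2 Σ_{t≥0} autocov κ π f (t+1)`.
§2 under an `m`-step minorisation `(nHit κ m)(x, ·) ≥ ε ν` (`0 < ε ≤ 1`, `0 < m`, `ν` a probability law):
**`abs_iterate_kop_centred_le_of_nHit`** (`|(kop κ)^[t] g x| ≤ 2C_g (1 − ε)^{⌊t/m⌋}` for centred `g`),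
**`poisson_exists_of_nHit`** (`|h| ≤ 2Cm/ε`), **`greenKubo_hasSum_of_nHit`**,
`poisson_inner_eq_of_nHit`, **`integral_sq_sub_sq_kop_eq_greenKubo_of_nHit`**.

NOT CLAIMED: unbounded observables; `L²(π)` spectral statements; optimal constants.
-/

namespace Summit.Ventures.LatticeQCDFlow.Exactness.GeneralNCMC

open MeasureTheory ProbabilityTheory Set Filter Finset
open scoped ENNReal Topology

variable {S : Type*} [MeasurableSpace S]

/-! ## §1 Poisson solution and Green–Kubo from an abstract decay envelope -/

section Envelope

variable {κ : Kernel S S} [IsMarkovKernel κ] {π : Measure S} [IsProbabilityMeasure π]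

omit [IsProbabilityMeasure π] in
/-- **Poisson solution from a summable sup-norm envelope.**  If `f` is bounded measurable and
`|(kop κ)^[t] f x| ≤ b_t` for all `t, x` with `Σ_t b_t < ∞`, then `h = Σ_t (kop κ)^[t] f` is a bounded
measurable solution of `h − kop κ h = f` with `|h| ≤ Σ_t b_t`. -/
theorem poisson_exists_of_envelope {f : S → ℝ} (hf : Measurable f) {C : ℝ} (hC : ∀ x, |f x| ≤ C)
    {b : ℕ → ℝ} (hb : Summable b) (hdecay : ∀ t x, |(Scoring.kop κ)^[t] f x| ≤ b t) :
    ∃ h : S → ℝ, Measurable h ∧ (∀ x, |h x| ≤ ∑' t, b t) ∧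
      ∀ x, h x - Scoring.kop κ h x = f x := by
  have hsum : ∀ x, Summable fun t => (Scoring.kop κ)^[t] f x := fun x =>
    Summable.of_norm_bounded hb fun t => by
      rw [Real.norm_eq_abs]; exact hdecay t x
  -- partial sums
  set T : ℕ → S → ℝ := fun N x => ∑ t ∈ Finset.range N, (Scoring.kop κ)^[t] f x with hT
  have hTm : ∀ N, Measurable (T N) := fun N =>
    Finset.measurable_sum _ fun t _ => (Scoring.iterate_kop_bounded_measurable κ hf hC t).1
  have hTb : ∀ N x, |T N x| ≤ ∑' t, b t := by
    intro N x
    have hb0 : ∀ t, 0 ≤ b t := fun t => (abs_nonneg _).trans (hdecay t x)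
    calc |T N x| ≤ ∑ t ∈ Finset.range N, |(Scoring.kop κ)^[t] f x| := Finset.abs_sum_le_sum_abs _ _
      _ ≤ ∑ t ∈ Finset.range N, b t := Finset.sum_le_sum fun t _ => hdecay t x
      _ ≤ ∑' t, b t := sum_le_hasSum _ (fun t _ => hb0 t) hb.hasSum
  have hlim : ∀ x, Tendsto (fun N => T N x) atTop (𝓝 (∑' t, (Scoring.kop κ)^[t] f x)) := fun x =>
    (hsum x).hasSum.tendsto_sum_nat
  refine ⟨fun x => ∑' t, (Scoring.kop κ)^[t] f x, ?_, ?_, fun x => ?_⟩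
  · exact measurable_of_tendsto_metrizable hTm (tendsto_pi_nhds.2 hlim)
  · intro x
    have h1 := tsum_of_norm_bounded hb.hasSum fun t => by
      rw [Real.norm_eq_abs]; exact hdecay t x
    rwa [Real.norm_eq_abs] at h1
  · have hrec : ∀ N, T (N + 1) x = f x + Scoring.kop κ (T N) x := by
      intro N
      have hlin : Scoring.kop κ (T N) x = ∑ t ∈ Finset.range N, (Scoring.kop κ)^[t + 1] f x := by
        show ∫ y, (∑ t ∈ Finset.range N, (Scoring.kop κ)^[t] f y) ∂(κ x) = _
        rw [integral_finsetSum _ fun t _ => ?_]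
        · refine Finset.sum_congr rfl fun t _ => ?_
          rw [Function.iterate_succ_apply']
          rfl
        · obtain ⟨hm, hb'⟩ := Scoring.iterate_kop_bounded_measurable κ hf hC t
          exact Scoring.integrable_of_bounded _ hm hb'
      rw [hlin]
      show ∑ t ∈ Finset.range (N + 1), (Scoring.kop κ)^[t] f x = _
      rw [Finset.sum_range_succ']
      simp only [Function.iterate_zero, id_eq]
      ring
    have hdct : Tendsto (fun N => Scoring.kop κ (T N) x) atTop
        (𝓝 (Scoring.kop κ (fun y => ∑' t, (Scoring.kop κ)^[t] f y) x)) := by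
      unfold Scoring.kop
      refine tendsto_integral_of_dominated_convergence (fun _ => ∑' t, b t)
        (fun N => (hTm N).aestronglyMeasurable) (integrable_const _) (fun N => ae_of_all _ fun y => ?_)
        (ae_of_all _ fun y => hlim y)
      rw [Real.norm_eq_abs]
      exact hTb N y
    have hlim1 : Tendsto (fun N => T (N + 1) x) atTop (𝓝 (∑' t, (Scoring.kop κ)^[t] f x)) :=
      (hlim x).comp (tendsto_add_atTop_nat 1)
    have hlim2 : Tendsto (fun N => T (N + 1) x) atTop
        (𝓝 (f x + Scoring.kop κ (fun y => ∑' t, (Scoring.kop κ)^[t] f y) x)) := by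
      simp_rw [hrec]
      exact tendsto_const_nhds.add hdct
    have heq := tendsto_nhds_unique hlim1 hlim2
    linarith

omit [IsMarkovKernel κ] in
/-- `|autocov κ π f t| ≤ C_f · sup |(kop κ)^[t] f|` — an envelope for `f` bounds its
autocovariances. -/
theorem abs_autocov_le_of_envelope {f : S → ℝ} {C : ℝ} (hC : ∀ x, |f x| ≤ C)
    {b : ℕ → ℝ} (hdecay : ∀ t x, |(Scoring.kop κ)^[t] f x| ≤ b t) (t : ℕ) :
    |Scoring.autocov κ π f t| ≤ C * b t := by
  have hC0 : 0 ≤ C := (abs_nonneg _).trans (hC (Classical.choice (nonempty_of_isProbabilityMeasure π)))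
  unfold Scoring.autocov
  rw [← Real.norm_eq_abs]
  calc ‖∫ x, f x * (Scoring.kop κ)^[t] f x ∂π‖ ≤ C * b t * π.real univ :=
        norm_integral_le_of_norm_le_const (Eventually.of_forall fun x => by
          rw [Real.norm_eq_abs, abs_mul]
          exact mul_le_mul (hC x) (hdecay t x) (abs_nonneg _) hC0)
    _ = C * b t := by rw [probReal_univ, mul_one]

/-- **The boundary term vanishes**: if every bounded centred observable decays in sup norm at a rate
`r_t → 0`, then `∫ f · (kop κ)^[T] h dπ → 0` for `f` bounded centred and `h` bounded measurable. -/
theorem tendsto_integral_mul_iterate_kop_of_decay {r : ℕ → ℝ} (hr : Tendsto r atTop (𝓝 0))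
    (hdec : ∀ (g : S → ℝ), Measurable g → ∀ (Cg : ℝ), (∀ x, |g x| ≤ Cg) → ∫ x, g x ∂π = 0 →
      ∀ t x, |(Scoring.kop κ)^[t] g x| ≤ 2 * Cg * r t)
    {f h : S → ℝ} (hf : Measurable f) {Cf : ℝ} (hCf : ∀ x, |f x| ≤ Cf) (hf0 : ∫ x, f x ∂π = 0)
    (hh : Measurable h) {Ch : ℝ} (hCh : ∀ x, |h x| ≤ Ch) :
    Tendsto (fun T => ∫ x, f x * (Scoring.kop κ)^[T] h x ∂π) atTop (𝓝 0) := by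
  have hCf0 : 0 ≤ Cf := (abs_nonneg _).trans (hCf (Classical.choice (nonempty_of_isProbabilityMeasure π)))
  -- the centred part of `h`
  set a : ℝ := ∫ x, h x ∂π with ha
  have hha : ∀ x, |h x - a| ≤ 2 * Ch := by
    intro x
    have h1 : |a| ≤ Ch := by
      rw [ha, ← Real.norm_eq_abs]
      calc ‖∫ x, h x ∂π‖ ≤ Ch * π.real univ :=
            norm_integral_le_of_norm_le_const (Eventually.of_forall fun x => by
              rw [Real.norm_eq_abs]; exact hCh x)
        _ = Ch := by rw [probReal_univ, mul_one]
    calc |h x - a| ≤ |h x| + |a| := abs_sub _ _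
      _ ≤ Ch + Ch := add_le_add (hCh x) h1
      _ = 2 * Ch := by ring
  have hham : Measurable fun x => h x - a := hh.sub measurable_const
  have hha0 : ∫ x, (h x - a) ∂π = 0 := by
    rw [integral_sub (Scoring.integrable_of_bounded π hh hCh) (integrable_const a), integral_const,
      probReal_univ, one_smul, ha, sub_self]
  have hdecay := hdec (fun x => h x - a) hham (2 * Ch) hha hha0
  -- `∫ f K^T h = ∫ f K^T (h − a)` since `f` is centred
  have hsplit : ∀ T, ∫ x, f x * (Scoring.kop κ)^[T] h x ∂π
      = ∫ x, f x * (Scoring.kop κ)^[T] (fun x => h x - a) x ∂π := by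
    intro T
    rw [Scoring.iterate_kop_sub_const (κ := κ) hh hCh a T]
    obtain ⟨hmT, hbT⟩ := Scoring.iterate_kop_bounded_measurable κ hh hCh T
    have hint1 : Integrable (fun x => f x * (Scoring.kop κ)^[T] h x) π :=
      Scoring.integrable_of_bounded π (hf.mul hmT) (C := Cf * Ch) fun x => by
        rw [abs_mul]; exact mul_le_mul (hCf x) (hbT x) (abs_nonneg _) hCf0
    have hint2 : Integrable (fun x => f x * a) π :=
      Scoring.integrable_of_bounded π (hf.mul measurable_const) (C := Cf * |a|) fun x => by
        rw [abs_mul]; exact mul_le_mul (hCf x) le_rfl (abs_nonneg _) hCf0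
    have : (fun x => f x * ((Scoring.kop κ)^[T] h x - a))
        = fun x => f x * (Scoring.kop κ)^[T] h x - f x * a := by funext x; ring
    rw [this, integral_sub hint1 hint2, integral_mul_const, hf0, zero_mul, sub_zero]
  simp_rw [hsplit]
  refine squeeze_zero_norm (fun T => ?_)
    (by simpa using (hr.const_mul (Cf * (2 * (2 * Ch)))))
  calc ‖∫ x, f x * (Scoring.kop κ)^[T] (fun x => h x - a) x ∂π‖
      ≤ Cf * (2 * (2 * Ch) * r T) * π.real univ :=
        norm_integral_le_of_norm_le_const (Eventually.of_forall fun x => by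
          rw [Real.norm_eq_abs, abs_mul]
          exact mul_le_mul (hCf x) (hdecay T x) (abs_nonneg _) hCf0)
    _ = Cf * (2 * (2 * Ch)) * r T := by rw [probReal_univ, mul_one]; ring

/-- **Green–Kubo from a decay rate.**  If every bounded centred observable decays in sup norm as
`|(kop κ)^[t] g| ≤ 2 C_g r_t` with `Σ_t r_t < ∞`, then for `f` bounded measurable centred and ANY
bounded measurable Poisson solution `h − kop κ h = f`:
`HasSum (t ↦ autocov κ π f t) (∫ f h dπ)`, i.e. `Σ_{t≥0} E_π[f(X_0) f(X_t)] = ⟨f, h⟩_π`. -/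
theorem greenKubo_hasSum_of_decay {r : ℕ → ℝ} (hr : Summable r)
    (hdec : ∀ (g : S → ℝ), Measurable g → ∀ (Cg : ℝ), (∀ x, |g x| ≤ Cg) → ∫ x, g x ∂π = 0 →
      ∀ t x, |(Scoring.kop κ)^[t] g x| ≤ 2 * Cg * r t)
    {f h : S → ℝ} (hf : Measurable f) {Cf : ℝ} (hCf : ∀ x, |f x| ≤ Cf) (hf0 : ∫ x, f x ∂π = 0)
    (hh : Measurable h) {Ch : ℝ} (hCh : ∀ x, |h x| ≤ Ch)
    (hpois : ∀ x, h x - Scoring.kop κ h x = f x) :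
    HasSum (fun t => Scoring.autocov κ π f t) (∫ x, f x * h x ∂π) := by
  have hsum : Summable fun t => Scoring.autocov κ π f t :=
    Summable.of_norm_bounded ((hr.mul_left (2 * Cf)).mul_left Cf) fun t => by
      rw [Real.norm_eq_abs]
      exact abs_autocov_le_of_envelope hCf (hdec f hf Cf hCf hf0) t
  rw [hsum.hasSum_iff_tendsto_nat]
  have hpart : (fun T => ∑ t ∈ Finset.range T, Scoring.autocov κ π f t)
      = fun T => ∫ x, f x * h x ∂π - ∫ x, f x * (Scoring.kop κ)^[T] h x ∂π :=
    funext fun T => Scoring.sum_autocov_eq_of_poisson hf hCf hh hCh hpois T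
  rw [hpart]
  simpa using (tendsto_integral_mul_iterate_kop_of_decay hr.tendsto_atTop_zero hdec hf hCf hf0
    hh hCh).const_sub (∫ x, f x * h x ∂π)

omit [IsMarkovKernel κ] in
/-- **Algebra of the martingale variance**: along a Poisson solution `h − kop κ h = f` (both bounded
measurable), `∫ h² dπ − ∫ (kop κ h)² dπ = 2 ∫ f h dπ − ∫ f² dπ`. -/
theorem integral_sq_sub_sq_kop_eq {f h : S → ℝ} (hf : Measurable f) {Cf : ℝ} (hCf : ∀ x, |f x| ≤ Cf)
    (hh : Measurable h) {Ch : ℝ} (hCh : ∀ x, |h x| ≤ Ch)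
    (hpois : ∀ x, h x - Scoring.kop κ h x = f x) :
    ∫ x, h x ^ 2 ∂π - ∫ x, (Scoring.kop κ h x) ^ 2 ∂π
      = 2 * ∫ x, f x * h x ∂π - ∫ x, f x ^ 2 ∂π := by
  have hCf0 : 0 ≤ Cf := (abs_nonneg _).trans (hCf (Classical.choice (nonempty_of_isProbabilityMeasure π)))
  have hCh0 : 0 ≤ Ch := (abs_nonneg _).trans (hCh (Classical.choice (nonempty_of_isProbabilityMeasure π)))
  have hkop : ∀ x, Scoring.kop κ h x = h x - f x := fun x => by linarith [hpois x]
  have hi1 : Integrable (fun x => h x ^ 2) π :=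
    Scoring.integrable_of_bounded π (hh.pow_const 2) (C := Ch ^ 2) fun x => by
      rw [abs_pow]; exact pow_le_pow_left₀ (abs_nonneg _) (hCh x) 2
  have hi2 : Integrable (fun x => f x * h x) π :=
    Scoring.integrable_of_bounded π (hf.mul hh) (C := Cf * Ch) fun x => by
      rw [abs_mul]; exact mul_le_mul (hCf x) (hCh x) (abs_nonneg _) hCf0
  have hi3 : Integrable (fun x => f x ^ 2) π :=
    Scoring.integrable_of_bounded π (hf.pow_const 2) (C := Cf ^ 2) fun x => by
      rw [abs_pow]; exact pow_le_pow_left₀ (abs_nonneg _) (hCf x) 2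
  have hexp : (fun x => (Scoring.kop κ h x) ^ 2) = fun x => h x ^ 2 - 2 * (f x * h x) + f x ^ 2 := by
    funext x; rw [hkop x]; ring
  rw [hexp, integral_add (hi1.sub' (hi2.const_mul 2)) hi3, integral_sub hi1 (hi2.const_mul 2),
    integral_const_mul]
  ring

/-- **THE MARTINGALE FORM OF THE ASYMPTOTIC VARIANCE.**  Under a summable decay rate, for `f`
bounded measurable centred and any bounded measurable Poisson solution `h`:
`∫ h² dπ − ∫ (kop κ h)² dπ = ∫ f² dπ + 2 Σ_{t≥0} autocov κ π f (t+1)` — the conditional-variance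
(martingale-increment) variance equals the Green–Kubo / integrated-autocorrelation variance. -/
theorem integral_sq_sub_sq_kop_eq_greenKubo {r : ℕ → ℝ} (hr : Summable r)
    (hdec : ∀ (g : S → ℝ), Measurable g → ∀ (Cg : ℝ), (∀ x, |g x| ≤ Cg) → ∫ x, g x ∂π = 0 →
      ∀ t x, |(Scoring.kop κ)^[t] g x| ≤ 2 * Cg * r t)
    {f h : S → ℝ} (hf : Measurable f) {Cf : ℝ} (hCf : ∀ x, |f x| ≤ Cf) (hf0 : ∫ x, f x ∂π = 0)
    (hh : Measurable h) {Ch : ℝ} (hCh : ∀ x, |h x| ≤ Ch)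
    (hpois : ∀ x, h x - Scoring.kop κ h x = f x) :
    ∫ x, h x ^ 2 ∂π - ∫ x, (Scoring.kop κ h x) ^ 2 ∂π
      = ∫ x, f x ^ 2 ∂π + 2 * ∑' t, Scoring.autocov κ π f (t + 1) := by
  have hGK := greenKubo_hasSum_of_decay hr hdec hf hCf hf0 hh hCh hpois
  have h0 : Scoring.autocov κ π f 0 = ∫ x, f x ^ 2 ∂π := by
    unfold Scoring.autocov
    simp only [Function.iterate_zero, id_eq]
    exact integral_congr_ae (ae_of_all _ fun x => by ring)
  have hshift := hGK.summable.sum_add_tsum_nat_add 1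
  rw [Finset.sum_range_one, hGK.tsum_eq, h0] at hshift
  rw [integral_sq_sub_sq_kop_eq hf hCf hh hCh hpois]
  linarith

end Envelope

/-! ## §2 Under an `m`-step Doeblin minorisation -/

section Power

variable {κ : Kernel S S} [IsMarkovKernel κ] {ν : Measure S} [IsProbabilityMeasure ν] {ε : ℝ≥0∞}
  {π : Measure S} [IsProbabilityMeasure π] {m : ℕ}

/-- **Sup-norm decay of centred observables under a Doeblin power**: if `(nHit κ m)(x, ·) ≥ ε ν`
(`ε ≤ 1`) and `π` is invariant, then for every bounded measurable `g` with `∫ g dπ = 0`,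
`|(kop κ)^[t] g x| ≤ 2 C_g (1 − ε)^{⌊t/m⌋}` for EVERY `x` and `t`. -/
theorem abs_iterate_kop_centred_le_of_nHit
    (hmin : ∀ x {B : Set S}, MeasurableSet B → ε * ν B ≤ nHit κ m x B) (hε1 : ε ≤ 1)
    (hπ : Kernel.Invariant κ π) {g : S → ℝ} (hg : Measurable g) {Cg : ℝ} (hCg : ∀ x, |g x| ≤ Cg)
    (hg0 : ∫ x, g x ∂π = 0) (t : ℕ) (x : S) :
    |(Scoring.kop κ)^[t] g x| ≤ 2 * Cg * (1 - ε.toReal) ^ (t / m) := by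
  haveI := isMarkovKernel_nHit κ t
  have hr0 : 0 ≤ 1 - ε.toReal :=
    sub_nonneg.2 (ENNReal.toReal_le_of_le_ofReal zero_le_one (by simpa using hε1))
  rw [iterate_kop_eq_integral_nHit hg hCg t x]
  rcases le_or_gt Cg 0 with hC | hC
  · -- then `g = 0`
    have hg' : ∀ y, g y = 0 := fun y => abs_nonpos_iff.1 ((hCg y).trans hC)
    have hCg0 : Cg = 0 := le_antisymm hC ((abs_nonneg _).trans (hCg x))
    simp [hg', hCg0]
  · -- rescale to `[0, 1]`
    set g' : S → ℝ := fun y => (g y + Cg) / (2 * Cg) with hg'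
    have hg'm : Measurable g' := (hg.add_const _).div_const _
    have h0 : ∀ y, 0 ≤ g' y := fun y => by
      rw [hg']
      exact div_nonneg (by linarith [neg_abs_le (g y), hCg y]) (by linarith)
    have h1 : ∀ y, g' y ≤ 1 := fun y => by
      rw [hg', div_le_one (by linarith)]
      linarith [le_abs_self (g y), hCg y]
    have hresc : ∀ (μ : Measure S) [IsProbabilityMeasure μ],
        ∫ y, g y ∂μ = 2 * Cg * ∫ y, g' y ∂μ - Cg := by
      intro μ _
      rw [hg']
      simp_rw [div_eq_inv_mul]
      rw [integral_const_mul, integral_add (Scoring.integrable_of_bounded μ hg hCg)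
        (integrable_const _), integral_const, probReal_univ, one_smul]
      field_simp
      ring
    have hb := doeblin_integral_nHit_sub_le_of_nHit hmin hε1 hπ x t hg'm h0 h1
    rw [show ∫ y, g y ∂(nHit κ t x) = ∫ y, g y ∂(nHit κ t x) - ∫ y, g y ∂π by rw [hg0, sub_zero],
      hresc (nHit κ t x), hresc π]
    rw [show 2 * Cg * ∫ y, g' y ∂(nHit κ t x) - Cg - (2 * Cg * ∫ y, g' y ∂π - Cg)
        = 2 * Cg * (∫ y, g' y ∂(nHit κ t x) - ∫ y, g' y ∂π) by ring, abs_mul,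
      abs_of_pos (by linarith : (0 : ℝ) < 2 * Cg)]
    exact mul_le_mul_of_nonneg_left hb (by linarith)

/-- **A bounded Poisson solution under a Doeblin power**: for `0 < ε ≤ 1`, `0 < m` and every bounded
measurable centred `f` there is a measurable `h` with `|h| ≤ 2 C m / ε` and `h − kop κ h = f`. -/
theorem poisson_exists_of_nHit
    (hmin : ∀ x {B : Set S}, MeasurableSet B → ε * ν B ≤ nHit κ m x B) (hε0 : 0 < ε) (hε1 : ε ≤ 1)
    (hm : 0 < m) (hπ : Kernel.Invariant κ π) {f : S → ℝ} (hf : Measurable f) {C : ℝ}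
    (hC : ∀ x, |f x| ≤ C) (hf0 : ∫ x, f x ∂π = 0) :
    ∃ h : S → ℝ, Measurable h ∧ (∀ x, |h x| ≤ 2 * C * m / ε.toReal) ∧
      ∀ x, h x - Scoring.kop κ h x = f x := by
  have hεtop : ε ≠ ∞ := ne_top_of_le_ne_top ENNReal.one_ne_top hε1
  have hεpos : 0 < ε.toReal := ENNReal.toReal_pos hε0.ne' hεtop
  have hr0 : 0 ≤ 1 - ε.toReal :=
    sub_nonneg.2 (ENNReal.toReal_le_of_le_ofReal zero_le_one (by simpa using hε1))
  have hr1 : 1 - ε.toReal < 1 := sub_lt_self _ hεpos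
  have hC0 : 0 ≤ C := (abs_nonneg _).trans (hC (Classical.choice (nonempty_of_isProbabilityMeasure π)))
  have hsum : Summable fun t : ℕ => 2 * C * (1 - ε.toReal) ^ (t / m) :=
    (Scoring.summable_pow_div hm hr0 hr1).mul_left (2 * C)
  obtain ⟨h, hhm, hhb, hpois⟩ := poisson_exists_of_envelope (κ := κ) hf hC hsum
    (fun t x => abs_iterate_kop_centred_le_of_nHit hmin hε1 hπ hf hC hf0 t x)
  refine ⟨h, hhm, fun x => (hhb x).trans ?_, hpois⟩
  rw [tsum_mul_left]
  calc 2 * C * ∑' t : ℕ, (1 - ε.toReal) ^ (t / m) ≤ 2 * C * (m / (1 - (1 - ε.toReal))) :=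
        mul_le_mul_of_nonneg_left (Scoring.tsum_pow_div_le hm hr0 hr1) (by positivity)
    _ = 2 * C * m / ε.toReal := by rw [sub_sub_cancel]; ring

/-- The decay-rate hypothesis of §1, discharged by a Doeblin power. -/
theorem decay_of_nHit
    (hmin : ∀ x {B : Set S}, MeasurableSet B → ε * ν B ≤ nHit κ m x B) (hε1 : ε ≤ 1)
    (hπ : Kernel.Invariant κ π) :
    ∀ (g : S → ℝ), Measurable g → ∀ (Cg : ℝ), (∀ x, |g x| ≤ Cg) → ∫ x, g x ∂π = 0 →
      ∀ t x, |(Scoring.kop κ)^[t] g x| ≤ 2 * Cg * (1 - ε.toReal) ^ (t / m) :=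
  fun _ hg _ hCg hg0 t x => abs_iterate_kop_centred_le_of_nHit hmin hε1 hπ hg hCg hg0 t x

/-- **Green–Kubo under a Doeblin power**: `HasSum (t ↦ autocov κ π f t) (∫ f h dπ)` for `f` bounded
measurable centred and any bounded measurable Poisson solution `h` (`0 < ε ≤ 1`, `0 < m`). -/
theorem greenKubo_hasSum_of_nHit
    (hmin : ∀ x {B : Set S}, MeasurableSet B → ε * ν B ≤ nHit κ m x B) (hε0 : 0 < ε) (hε1 : ε ≤ 1)
    (hm : 0 < m) (hπ : Kernel.Invariant κ π)
    {f h : S → ℝ} (hf : Measurable f) {Cf : ℝ} (hCf : ∀ x, |f x| ≤ Cf) (hf0 : ∫ x, f x ∂π = 0)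
    (hh : Measurable h) {Ch : ℝ} (hCh : ∀ x, |h x| ≤ Ch)
    (hpois : ∀ x, h x - Scoring.kop κ h x = f x) :
    HasSum (fun t => Scoring.autocov κ π f t) (∫ x, f x * h x ∂π) := by
  have hεtop : ε ≠ ∞ := ne_top_of_le_ne_top ENNReal.one_ne_top hε1
  have hεpos : 0 < ε.toReal := ENNReal.toReal_pos hε0.ne' hεtop
  have hr0 : 0 ≤ 1 - ε.toReal :=
    sub_nonneg.2 (ENNReal.toReal_le_of_le_ofReal zero_le_one (by simpa using hε1))
  have hr1 : 1 - ε.toReal < 1 := sub_lt_self _ hεpos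
  exact greenKubo_hasSum_of_decay (Scoring.summable_pow_div hm hr0 hr1)
    (decay_of_nHit hmin hε1 hπ) hf hCf hf0 hh hCh hpois

/-- Uniqueness of `⟨f, h⟩_π` over bounded Poisson solutions, under a Doeblin power. -/
theorem poisson_inner_eq_of_nHit
    (hmin : ∀ x {B : Set S}, MeasurableSet B → ε * ν B ≤ nHit κ m x B) (hε0 : 0 < ε) (hε1 : ε ≤ 1)
    (hm : 0 < m) (hπ : Kernel.Invariant κ π)
    {f h h' : S → ℝ} (hf : Measurable f) {Cf : ℝ} (hCf : ∀ x, |f x| ≤ Cf) (hf0 : ∫ x, f x ∂π = 0)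
    (hh : Measurable h) {Ch : ℝ} (hCh : ∀ x, |h x| ≤ Ch)
    (hpois : ∀ x, h x - Scoring.kop κ h x = f x)
    (hh' : Measurable h') {Ch' : ℝ} (hCh' : ∀ x, |h' x| ≤ Ch')
    (hpois' : ∀ x, h' x - Scoring.kop κ h' x = f x) :
    ∫ x, f x * h x ∂π = ∫ x, f x * h' x ∂π :=
  (greenKubo_hasSum_of_nHit hmin hε0 hε1 hm hπ hf hCf hf0 hh hCh hpois).unique
    (greenKubo_hasSum_of_nHit hmin hε0 hε1 hm hπ hf hCf hf0 hh' hCh' hpois')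

/-- **The martingale form of the asymptotic variance under a Doeblin power**:
`∫ h² dπ − ∫ (kop κ h)² dπ = ∫ f² dπ + 2 Σ_{t≥0} autocov κ π f (t+1)`. -/
theorem integral_sq_sub_sq_kop_eq_greenKubo_of_nHit
    (hmin : ∀ x {B : Set S}, MeasurableSet B → ε * ν B ≤ nHit κ m x B) (hε0 : 0 < ε) (hε1 : ε ≤ 1)
    (hm : 0 < m) (hπ : Kernel.Invariant κ π)
    {f h : S → ℝ} (hf : Measurable f) {Cf : ℝ} (hCf : ∀ x, |f x| ≤ Cf) (hf0 : ∫ x, f x ∂π = 0)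
    (hh : Measurable h) {Ch : ℝ} (hCh : ∀ x, |h x| ≤ Ch)
    (hpois : ∀ x, h x - Scoring.kop κ h x = f x) :
    ∫ x, h x ^ 2 ∂π - ∫ x, (Scoring.kop κ h x) ^ 2 ∂π
      = ∫ x, f x ^ 2 ∂π + 2 * ∑' t, Scoring.autocov κ π f (t + 1) := by
  have hεtop : ε ≠ ∞ := ne_top_of_le_ne_top ENNReal.one_ne_top hε1
  have hεpos : 0 < ε.toReal := ENNReal.toReal_pos hε0.ne' hεtop
  have hr0 : 0 ≤ 1 - ε.toReal :=
    sub_nonneg.2 (ENNReal.toReal_le_of_le_ofReal zero_le_one (by simpa using hε1))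
  have hr1 : 1 - ε.toReal < 1 := sub_lt_self _ hεpos
  exact integral_sq_sub_sq_kop_eq_greenKubo (Scoring.summable_pow_div hm hr0 hr1)
    (decay_of_nHit hmin hε1 hπ) hf hCf hf0 hh hCh hpois

end Power

end Summit.Ventures.LatticeQCDFlow.Exactness.GeneralNCMC
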